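import Literature.AlgebraicGeometry.Resolution.ProperModelsRegModel
import HarnessLib

/-!
# Stub `stub_regModelAt_of_resOver` (crux stmt-ResolutionOfSingularities-0552, line `Sketch` rev. c6)

Glue stub of the skeleton `Sketch` (rev. c6) for the crux `PalterationThesis`
(stmt-ResolutionOfSingularities-0552), certifying that the rev. c6 reshape through Zariski's two
problems loses nothing: over ONE field `K` (no perfectness, no characteristic hypothesis),
resolution of every reduced separated `K`-scheme of finite type (`Res_K`, the hypothesis `hres`)
gives `RegModel_K` — every `F/K` essentially of finite type having a proper model has a REGULAR
proper model. This is the fieldwise form of `ProperModel.regModel_of_resolutionInChar`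
(`Literature/AlgebraicGeometry/Resolution/ProperModelsRegModel.lean`): the scheme `M.X` of a
proper model `M` is integral (hence reduced) and `M.π : M.X → Spec K` is proper (hence separated,
quasi-compact, locally of finite type), so `hres` resolves it, and a resolution of a proper model
is a regular proper model dominating it (`ProperModel.exists_hom_isRegular_of_hasResolution`).
-/

set_option linter.dupNamespace false

noncomputable section

open CategoryTheory AlgebraicGeometry
open Literature.AlgebraicGeometry.Resolution

namespace Summit.ResolutionOfSingularities.ResolutionOfSingularities.Theorems.PalterationThesis.ZariskiPerfect

/-- GLUE STUB (worker B, certification: the reshape loses nothing): over a field `K`, resolution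
of every reduced separated `K`-scheme of finite type gives a regular proper model of every
function field having a proper model (resolve the model; the fieldwise form of
`ProperModel.regModel_of_resolutionInChar`). [folklore] -/
theorem stub_regModelAt_of_resOver (K : Type) [Field K]
    (hres : ∀ (X : Scheme.{0}) (f : X ⟶ Spec (.of K)),
      IsSeparated f → LocallyOfFiniteType f → QuasiCompact f → IsReduced X →
      Scheme.HasResolution X) :
    ∀ (F : Type) [Field F] [Algebra K F] [Algebra.EssFiniteType K F],
      Nonempty (ProperModel K F) → ∃ N : ProperModel K F, Scheme.IsRegular N.X := by
  intro F _ _ _ hM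
  obtain ⟨M⟩ := hM
  obtain ⟨N, -, hN⟩ := ProperModel.exists_hom_isRegular_of_hasResolution M
    (hres M.X M.π inferInstance inferInstance inferInstance inferInstance)
  exact ⟨N, hN⟩

end Summit.ResolutionOfSingularities.ResolutionOfSingularities.Theorems.PalterationThesis.ZariskiPerfect

end
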